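/-
Copyright (c) 2026 the pub-hodgecm-mathlib formalisation cell (harness21).  Prover seat hodgecm-mathlib-K2Liu-p08 (g5), Track B «K2-LIT»,
#184♮ = hLiu418 = `stmt-HodgeConjecture-24832`; #42S organ S1 ROAD W, hole (iv) «`S_δ`» of the named input S1-exc AT THE SPLIT PLACES, file (δ1s):
★ (B5)-split `K2LiuLocalSWDualBoxIndexSplit` WITHOUT THE LETTER `hδu` — the split twin of K2Liu-p01 (g10)'s ★ (δ1) `K2LiuLocalSWDualBoxIndexOfNeZero`.
-/
import Summits.HodgeConjecture.HodgeConjecture.Theorems.K2LiuLocalSWDualBoxIndexSplit        -- ★ (B5)-split `relIndex∕card_quotient_inf_box_eq_pow_split` (with `hδu`), `valued_toPlace_eq_of_split`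
import Summits.HodgeConjecture.HodgeConjecture.Theorems.K2LiuLocalSWDualBoxIndexOfNeZero    -- ★ (δ1) `valued_toPlace_eq_of_uniformizer`, `ne_one_of_apply_eq_neg`
import HarnessLib

/-!
# Crux `HLiu418`, #42S-S1 ROAD W, hole (iv) «`S_δ`» at a SPLIT place, file (δ1s): THE INDEX `q_v^{4m}` OF THE DUAL BOXES WITHOUT `hδu`

Cell `hodgecm-mathlib`, crux item hLiu418 = `stmt-HodgeConjecture-24832` (helper lane `--supports … --as helper`, count-neutral).  THEOREMS ONLY (no `def`, no instance,
no notation, no named-fact hypothesis, no `sorry`).  Currency of ★ (B5)-split: quadratic `E/F` with `c`, purely imaginary `δ ≠ 0` (`hcδ hδ`), finite place `v` with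
uniformiser `π` (`hπ`), `T₀` symmetric invertible, the skew subgroup `𝔰 = S` (`hS`), a SPLIT place `w₀` (`hw₀ : c • w₀ ≠ w₀`), the dual boxes `Λ_j` BY VALUE through their
carriers `{t | ∀ i i′ w, |(δ̂·(𝕋₀t))_{ii′}|_w ≤ |ι_wπ|_w^{c₀ − j − [i=i′]e₂}}` (★ (B) `exists_addSubgroup_box`).

WHY.  ★ (B5)-split (and through it ★ (J)-split-witness `K2LiuSplitWitnessProfileSumFamily.sum_two_depths_ne_zero_split_witness`, ★ (P1)-split ED. 1∕2∕3, ★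
`K2LiuLocalSWSpanningSplitOfMiddleRows`) carries `hδu : ∀ w, |δ̂|_w = 1` — false at the finitely many split places `v ∈ S_δ` where the global purely imaginary `δ` (for the
K2Lit chain `δ = imagUnit L`) is not a `w`-unit.  Exactly as in p01's inert (δ1): the index is SHIFT-INVARIANT and the box family sees `δ` only through `|δ̂|_w`, which at a
split `v` is THE SAME at both places above `v` (`|δ̂|_{c⁻¹•w₀} = |c δ|_{w₀} = |−δ|_{w₀}`, ★ `valuation_algEquiv_smul`) — `= P^e` with `P = exp(−1) = |ι_wπ|_w` at both `w`
(★ `valued_toPlace_eq_of_split`); with a GLOBAL uniformiser `π_F ∈ F` at `v` the element `δ′ := π_F^{−e}·δ ∈ E` is purely imaginary, non-zero, a unit at every `w ∣ v`, and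
**`BOX_j(δ, c₀) = BOX_j(δ′, c₀ − e)`** — so ★ (B5)-split at `(δ′, c₀ − e)` computes the index of the SAME family `Λ`:
* `exists_unit_rescale_split`: `∃ δ′ e, c δ′ = −δ′ ∧ δ′ ≠ 0 ∧ (∀ w, |δ̂′|_w = 1) ∧ ∀ j, BOX_j(δ, c₀) = BOX_j(δ′, c₀ − e)`;
* **`relIndex_inf_box_eq_pow_split_of_ne_zero`**, **`card_quotient_inf_box_eq_pow_split_of_ne_zero`** = ★ (B5)-split's two heads with the binder `hδu` DELETED.
Downstream (files (δ4s)–(δ5s) of this hand): `hδu` disappears from ★ (J)-split-witness, ★ ED. 2∕3 and ★ `…SplitOfMiddleRows`; `vd = ord_v(δ²)` stays free in `hdn`∕`hc₀`.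
[Shimura1997, §13.2, §13.5] [BushnellHenniart2006, §1.1] [CasselsFrohlichANT1967, Ch. II §10, Ch. VII Prop. 1.2].
HONEST LABEL.  Count-neutral helper; `HC_CM` is proved only modulo the 7 printed citations (2 remaining named inputs: hLiu418 = `stmt-HodgeConjecture-24832`,
h413 = `stmt-HodgeConjecture-24833`) until rung 0 closes.  NOT here: (δ4s)–(δ5s), the finiteness letter (★ `finite_skewQuotient_box` is already `hδu`-free).

## References
* [Shimura1997] G. Shimura, *Euler Products and Eisenstein Series*, CBMS 93 (1997), §13.2, §13.5.
* [BushnellHenniart2006] C. Bushnell, G. Henniart, *The Local Langlands Conjecture for GL(2)* (2006), §1.1.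
* [CasselsFrohlichANT1967] Cassels–Fröhlich, *Algebraic Number Theory* (1967), Ch. II §10, Ch. VII Prop. 1.2.
-/

set_option autoImplicit false
set_option linter.dupNamespace false -- the mandated namespace repeats `HodgeConjecture.HodgeConjecture`

noncomputable section

open scoped Matrix
open NumberField IsDedekindDomain Matrix
open Literature.NumberTheory.Automorphic Literature.NumberTheory.Automorphic.UnitaryGroup
open Literature.NumberTheory.GelbartRogawski1991.UnitaryDualPair Literature.NumberTheory.GelbartRogawski1991.UnitaryDualPair.LocalSplitting

namespace Summit.HodgeConjecture.HodgeConjecture.Cruxes.HLiu418.K2LiuLocalSWDualBoxIndexSplitOfNeZero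

open K2LiuLocalRingValuationBalls K2LiuLocalSWDualBoxIndexSplit
open K2LiuLocalSWDualBoxIndexOfNeZero (valued_toPlace_eq_of_uniformizer ne_one_of_apply_eq_neg)

variable (F : Type) [Field F] [NumberField F] (E : Type) [Field E] [NumberField E] [Algebra F E] [Algebra.IsQuadraticExtension F E]
  (c : E ≃ₐ[F] E) {δ : E} (hcδ : c δ = -δ) (hδ : δ ≠ 0)
  (v : HeightOneSpectrum (𝓞 F)) {π : v.adicCompletion F} (hπ : Valued.v π = WithZero.exp (-1 : ℤ))
  {T₀ : Matrix (Fin 2) (Fin 2) F} (hT₀ : T₀.IsSymm) (hT₀d : IsUnit T₀.det)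
  (S : AddSubgroup (Matrix (Fin 2) (Fin 2) (LocalRing E v)))
  (hS : ∀ t, t ∈ S ↔ (t.map (conjLocal E c v))ᵀ * gramS F E v 2 T₀ + gramS F E v 2 T₀ * t = 0)
  (w₀ : PlacesOver E v) (hw₀ : c • w₀.1 ≠ w₀.1)

/-! ## §1 `|δ̂|_w` is the same at both places above a split `v`; the unit rescaling `δ′ = π_F^{−e}·δ` -/

include hcδ hw₀ in
/-- **at a split `v` the valuation of `δ̂` is the same at every `w ∣ v`**: the places above `v` are `w₀` and `c⁻¹ • w₀`, and `|δ|_{c⁻¹•w₀} = |c δ|_{w₀} = |−δ|_{w₀}`.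
[cite: CasselsFrohlichANT1967, Ch. VII Prop. 1.2] -/
theorem valued_algebraMap_eq_of_split (w : PlacesOver E v) :
    Valued.v (algebraMap E (LocalRing E v) δ w) = Valued.v (algebraMap E (LocalRing E v) δ w₀) := by
  have hc : c ≠ 1 := fun h => hw₀ (by rw [h, one_smul])
  have key : ∀ w' : PlacesOver E v, Valued.v (algebraMap E (LocalRing E v) δ w') = w'.1.valuation E δ := fun w' => by
    rw [Pi.algebraMap_apply, HeightOneSpectrum.algebraMap_adicCompletion]
    simp
  rw [key, key]
  rcases PlacesOver.eq_or_eq_galInv c hc w₀ w with rfl | rfl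
  · rfl
  · have h := HeightOneSpectrum.valuation_algEquiv_smul (F := F) c (c⁻¹ • w₀.1) δ
    rw [smul_inv_smul, hcδ, Valuation.map_neg] at h
    exact h.symm

include hcδ hδ hπ hw₀ in
/-- **THE UNIT RESCALING AT A SPLIT PLACE**: there are `δ′ ∈ E` purely imaginary non-zero with `|δ̂′|_w = 1` for all `w ∣ v` and `e ∈ ℤ` with `BOX_j(δ, c₀) = BOX_j(δ′, c₀ − e)`
for every `j` (`δ′ = π_F^{−e}·δ`, `π_F ∈ F` a global uniformiser at `v`, `|δ̂|_w = P^e` at both places). [cite: CasselsFrohlichANT1967, Ch. II §10] -/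
theorem exists_unit_rescale_split (c₀ e₂ : ℤ) :
    ∃ (δ' : E) (e : ℤ), c δ' = -δ' ∧ δ' ≠ 0 ∧ (∀ w : PlacesOver E v, Valued.v (algebraMap E (LocalRing E v) δ' w) = 1) ∧
      ∀ j : ℤ, {t : Matrix (Fin 2) (Fin 2) (LocalRing E v) | ∀ i i' (w : PlacesOver E v),
          Valued.v ((algebraMap E (LocalRing E v) δ • (gramS F E v 2 T₀ * t)) i i' w) ≤ Valued.v (toPlace v w π) ^ (c₀ - j - if i = i' then e₂ else 0)} =
        {t : Matrix (Fin 2) (Fin 2) (LocalRing E v) | ∀ i i' (w : PlacesOver E v),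
          Valued.v ((algebraMap E (LocalRing E v) δ' • (gramS F E v 2 T₀ * t)) i i' w) ≤ Valued.v (toPlace v w π) ^ ((c₀ - e) - j - if i = i' then e₂ else 0)} := by
  have hPw : ∀ w : PlacesOver E v, Valued.v (toPlace v w π) = WithZero.exp (-1 : ℤ) := fun w => valued_toPlace_eq_of_split F E c v hπ w₀ hw₀ w
  -- `|δ̂|_{w} = P^e` at every `w ∣ v`
  have hδw : algebraMap E (LocalRing E v) δ w₀ ≠ 0 := fun h => hδ (by
    rw [Pi.algebraMap_apply] at h
    exact (map_eq_zero_iff _ (algebraMap E (w₀.1.adicCompletion E)).injective).1 h)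
  obtain ⟨e, he⟩ : ∃ e : ℤ, Valued.v (algebraMap E (LocalRing E v) δ w₀) = WithZero.exp (-1 : ℤ) ^ e :=
    ⟨-WithZero.log (Valued.v (algebraMap E (LocalRing E v) δ w₀)), by
      rw [← WithZero.exp_zsmul, smul_eq_mul, mul_neg, mul_one, neg_neg, WithZero.exp_log ((Valuation.ne_zero_iff _).2 hδw)]⟩
  have he' : ∀ w : PlacesOver E v, Valued.v (algebraMap E (LocalRing E v) δ w) = Valued.v (toPlace v w π) ^ e := fun w => by
    rw [valued_algebraMap_eq_of_split F E c hcδ v w₀ hw₀ w, he, hPw w]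
  -- a global uniformiser `π_F` at `v`; `|ι_w π_F| = P` at every `w ∣ v`
  obtain ⟨πF, hπF⟩ := v.valuation_exists_uniformizer F
  have hπF0 : (πF : F) ≠ 0 := by
    intro h
    rw [h, map_zero] at hπF
    exact WithZero.zero_ne_coe hπF
  -- `δ′ = π_F^{−e}·δ` is a `w`-unit
  have hunit : ∀ w : PlacesOver E v, Valued.v (algebraMap E (LocalRing E v) (algebraMap F E (πF ^ (-e)) * δ) w) = 1 := by
    intro w
    rw [map_mul, Pi.mul_apply, map_mul, ← toLocalRing_coe, toLocalRing_apply, valued_toPlace_eq_of_uniformizer F E v hπ w (hPw w),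
      HeightOneSpectrum.valuedAdicCompletion_eq_valuation', map_zpow₀, hπF, he' w, hPw w, ← zpow_add₀ WithZero.coe_ne_zero, neg_add_cancel, zpow_zero]
  refine ⟨algebraMap F E (πF ^ (-e)) * δ, e, ?_, ?_, hunit, fun j => Set.ext fun t => ?_⟩
  · rw [map_mul, AlgEquiv.commutes, hcδ, mul_neg]
  · exact mul_ne_zero ((map_ne_zero_iff _ (algebraMap F E).injective).2 (zpow_ne_zero _ hπF0)) hδ
  · simp only [Set.mem_setOf_eq]
    refine forall_congr' fun i => forall_congr' fun i' => forall_congr' fun w => ?_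
    have hP : Valued.v (toPlace v w π) ≠ 0 := by rw [hPw w]; exact WithZero.coe_ne_zero
    have hX : ∀ u : E, (algebraMap E (LocalRing E v) u • (gramS F E v 2 T₀ * t)) i i' w = algebraMap E (LocalRing E v) u w * (gramS F E v 2 T₀ * t) i i' w :=
      fun u => by rw [Matrix.smul_apply, smul_eq_mul, Pi.mul_apply]
    rw [hX, hX, map_mul, map_mul, he' w, hunit w, one_mul, show c₀ - e - j - (if i = i' then e₂ else 0) = (c₀ - j - if i = i' then e₂ else 0) - e by ring,
      zpow_sub₀ hP (c₀ - j - if i = i' then e₂ else 0) e, le_div_iff₀ (zpow_pos (zero_lt_iff.2 hP) e), mul_comm]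

/-! ## §2 ★ (B5)-split without `hδu` -/

include hcδ hδ hπ hT₀ hT₀d hS hw₀ in
/-- **`[𝔰 ∩ Λ_m : 𝔰 ∩ Λ_0] = q_v^{4m}` AT A SPLIT PLACE WITHOUT `hδu`** (★ (B5)-split `relIndex_inf_box_eq_pow_split` at the unit rescaling `(δ′, c₀ − e)` of §1 — the same
family `Λ`). [cite: Shimura1997, §13.5] [cite: BushnellHenniart2006, §1.1] -/
theorem relIndex_inf_box_eq_pow_split_of_ne_zero (c₀ e₂ : ℤ)
    (Λ : ℤ → AddSubgroup (Matrix (Fin 2) (Fin 2) (LocalRing E v)))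
    (hΛ : ∀ j : ℤ, (Λ j : Set (Matrix (Fin 2) (Fin 2) (LocalRing E v))) = {t | ∀ i i' (w : PlacesOver E v),
      Valued.v ((algebraMap E (LocalRing E v) δ • (gramS F E v 2 T₀ * t)) i i' w) ≤ Valued.v (toPlace v w π) ^ (c₀ - j - if i = i' then e₂ else 0)})
    (m : ℕ) : (S ⊓ Λ 0).relIndex (S ⊓ Λ m) = v.residueCard ^ (4 * m) := by
  obtain ⟨δ', e, hcδ', hδ', hδu', hbox⟩ := exists_unit_rescale_split F E c hcδ hδ v hπ w₀ hw₀ c₀ e₂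
  exact relIndex_inf_box_eq_pow_split F E c hcδ' hδ' v hπ hT₀ hT₀d S hS w₀ hw₀ hδu' (c₀ - e) e₂ Λ (fun j => (hΛ j).trans (hbox j)) m

include hcδ hδ hπ hT₀ hT₀d hS hw₀ in
/-- **THE `hcard` LETTER AT A SPLIT PLACE WITHOUT `hδu`**: `Fintype.card (𝔰 ∩ Λ_m ⧸ 𝔰 ∩ Λ_0) = q_v^{4m}` (★ (B5)-split `card_quotient_inf_box_eq_pow_split` at the unit
rescaling of §1) — the `hcard` line of (δ4s) `K2LiuSplitWitnessProfileSumFamilyOfNeZero`. [cite: Shimura1997, §13.5] [cite: BushnellHenniart2006, §1.1] -/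
theorem card_quotient_inf_box_eq_pow_split_of_ne_zero (c₀ e₂ : ℤ)
    (Λ : ℤ → AddSubgroup (Matrix (Fin 2) (Fin 2) (LocalRing E v)))
    (hΛ : ∀ j : ℤ, (Λ j : Set (Matrix (Fin 2) (Fin 2) (LocalRing E v))) = {t | ∀ i i' (w : PlacesOver E v),
      Valued.v ((algebraMap E (LocalRing E v) δ • (gramS F E v 2 T₀ * t)) i i' w) ≤ Valued.v (toPlace v w π) ^ (c₀ - j - if i = i' then e₂ else 0)})
    (m : ℕ) [Fintype (↥(S ⊓ Λ m) ⧸ (S ⊓ Λ 0).addSubgroupOf (S ⊓ Λ m))] :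
    Fintype.card (↥(S ⊓ Λ m) ⧸ (S ⊓ Λ 0).addSubgroupOf (S ⊓ Λ m)) = v.residueCard ^ (4 * m) := by
  obtain ⟨δ', e, hcδ', hδ', hδu', hbox⟩ := exists_unit_rescale_split F E c hcδ hδ v hπ w₀ hw₀ c₀ e₂
  exact card_quotient_inf_box_eq_pow_split F E c hcδ' hδ' v hπ hT₀ hT₀d S hS w₀ hw₀ hδu' (c₀ - e) e₂ Λ (fun j => (hΛ j).trans (hbox j)) m

end Summit.HodgeConjecture.HodgeConjecture.Cruxes.HLiu418.K2LiuLocalSWDualBoxIndexSplitOfNeZero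

end
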